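import Summits.BirchSwinnertonDyer.Rank1Residual.X10.UnitRoad
import HarnessLib

/-!
# Class X10b (N2), the UNIT ROAD at `p = 3`: per-pair kernel RECORDS, part I — X_A3
# (`MazurMainConjecture W 3`) AT THE PAIR for 7 N2 cells with trivial `3`-primary arithmetic
# (354482b1, 370999a1, 370999b1, 372416df1, 406783b1, 440896k1, 440896l1) (cell `b2b-bsdres`, unit `b2b-bsdres-x10` = N2 class lead, gen 24)

HONEST FRAMING (run/shared/lean/b2b/bsd-rank1-residual/, verbatim in every file): the goal of the
cell is to DELETE the COMBINATION-SHAPED residual classes of the Birch–Swinnerton-Dyer formula for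
ALL analytic-rank `≤ 1` elliptic curves over `ℚ` — "full BSD formula for every rank `≤ 1` curve in
class `C`" assembled STRICTLY from published theorems — so that the rank-`≤ 1` remainder becomes
exactly the CONSTRUCTION-SHAPED classes, which are TYPED (missing-input `Prop`s), NOT attempted.
This is not "finishing BSD". Theorems only; NO definition, NO named fact; class X10b keeps its label
CONSTRUCTION-SHAPED (NEEDS X_A3, referee R82.3 / RESIDUAL-MAP §I N2); nothing is booked by this file
(the lane books, the referee rules); everything is PER PAIR; no census number moves.

## What (x10 GEN 24, X10-AUDIT §30; `class-closure/N2/LAMBDA-SUBPARTITION-x10g24.md`)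

For each cell `E` below — an N2 cell of record (`class-closure/N2/pairs.tsv`; `p = 3` good ordinary,
`E[3]` irreducible with image a Cartan normaliser, census image type in the record's docstring) of
analytic rank `0` with TRIVIAL `3`-PRIMARY ARITHMETIC in Cremona's table (`a₃ ≢ 1 (mod 3)`,
`3 ∤ ∏ c_ℓ`, `3 ∤ #Ш_an`, `#E(ℚ)_tors` prime to `3`) — the record
`mazurMainConjecture_unit_u<label>` is the cell's typed missing input X_A3 AT THE PAIR,
`MazurMainConjecture W 3` (`W` any globally minimal curve whose integral model is Cremona's), from
`UnitRoad.mazurMainConjecture_three_of_ainvs_of_trivialArithmetic` (x10 gen 24; = x9 gen 5's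
`mazurMainConjecture_with_mu_zero_of_trivialArithmetic_odd` read off the integer model) with, IN THE
KERNEL: `3 ∤ Δ`, `#Ẽ(𝔽₃) = n₃` (`decide`; `3 ∤ 4 − n₃`: ordinary; `3 ∤ n₃`: NON-ANOMALOUS), and a
Frobenius witness `ℓ` (`#Ẽ(𝔽_ℓ) = n`, `X² − (ℓ+1−n)X + ℓ` root-free mod `3`: `E[3]` irreducible,
Mazur 1978 Prop. 6.3 (1)). DISPLAYED binders: PUBLISHED `hkato` (Kato 2004 Thm. 17.4 (1)), `hGr`
(Greenberg 1999 Thm. 4.1), `h5`/`h3` (period unit); CENSUS `htam : 3 ∤ ∏ c_ℓ(E)`,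
`hL : L(E,1)/Ω_E` a nonzero rational `3`-adic unit, `hSel : #Sel_{3^∞}(E/ℚ) = 1` (Cremona `allbsd`:
rank `0`, `∏ c_ℓ`, `#Ш_an`, `#E(ℚ)_tors` as quoted per record; the lane's `3`-descent certificate
`dim Sel₃(E) = 0` where on file); instance binders `[W.IsElliptic] [W.IsGloballyMinimal]`. NO
Greenberg–Vatsal, NO Rubin, NO Yan–Zhu, NO `μ`-certificate, NO CM partner. READING: at these pairs the
main conjecture is a triviality (unit `3`-adic `L`-function, `X(E/ℚ_∞)` of unit characteristic series);
the class-level statement and the 138 ANOMALOUS cells are untouched. Data script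
`HOME/b2b-bsdres-x10/g24/gen/{unitdata,mkrecords}.py` (stdlib; Cremona ecdata).

References: K. Kato, Astérisque 295 (2004) Thm. 17.4 (1) [Kato2004Asterisque]; R. Greenberg, LNM
1716 (1999) Thm. 4.1, Prop. 3.8 [GreenbergLNM1716]; B. Mazur, Invent. Math. 44 (1978) Prop. 6.3 (1)
[Mazur1978]; J. E. Cremona, *Algorithms for Modular Elliptic Curves*, tables [Cremona2006].
-/

set_option autoImplicit false

noncomputable section

open scoped Classical MatrixGroups ModularForm

open CongruenceSubgroup WeierstrassCurve Literature.NumberTheory.EllipticCurves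
  Literature.NumberTheory.EllipticCurves.ModularForms Literature.NumberTheory.EllipticCurves.Rank1Residual
  Literature.NumberTheory.EllipticCurves.Rank1Residual.X11RankOneCertificates
  Summit.BirchSwinnertonDyer.BirchSwinnertonDyer.Rank1Residual.IntModel
  Summit.BirchSwinnertonDyer.BirchSwinnertonDyer.Rank1Residual.X11RankOne
  Summit.BirchSwinnertonDyer.BirchSwinnertonDyer.Theorems.Rank1ResidualX1Defs

namespace Summit.BirchSwinnertonDyer.Rank1Residual.X10.UnitRoad

/-! ### `354482b1` (3Ns, N = 354482) -/

/-- `#Ẽ(𝔽_{3}) = 2` (`a₃ = 2`: good ORDINARY and NON-ANOMALOUS at `3`) for Cremona's model `354482b1` (kernel count). [folklore] -/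
theorem card_u354482b1_3 :
    Nat.card (((⟨1, 1, 0, (-7060), (-218544)⟩ : WeierstrassCurve ℤ).map (Int.castRingHom (ZMod 3))).toAffine.Point) = 2 := by
  rw [@WeierstrassCurve.natCard_point_eq_one_add_card (ZMod 3) (@ZMod.instField 3 ⟨by norm_num⟩) _ _ _
    (by decide +kernel), @card_sol_eq_sum_euler (ZMod 3) (@ZMod.instField 3 ⟨by norm_num⟩) _ _
    (by rw [ZMod.ringChar_zmod_n]; decide), ZMod.card]
  decide +kernel

/-- `#Ẽ(𝔽_{13}) = 17` (`a_{13} = -3`; `X² − a_{13}X + 13` root-free mod `3`) for Cremona's model `354482b1` (kernel count). [folklore] -/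
theorem card_u354482b1_13 :
    Nat.card (((⟨1, 1, 0, (-7060), (-218544)⟩ : WeierstrassCurve ℤ).map (Int.castRingHom (ZMod 13))).toAffine.Point) = 17 := by
  rw [@WeierstrassCurve.natCard_point_eq_one_add_card (ZMod 13) (@ZMod.instField 13 ⟨by norm_num⟩) _ _ _
    (by decide +kernel), @card_sol_eq_sum_euler (ZMod 13) (@ZMod.instField 13 ⟨by norm_num⟩) _ _
    (by rw [ZMod.ringChar_zmod_n]; decide), ZMod.card]
  decide +kernel

/-- **X_A3 AT THE PAIR `(354482b1, 3)` by the UNIT ROAD: `MazurMainConjecture W 3`.** Cremona model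
`[1, 1, 0, -7060, -218544]`, `N = 354482 = 2 · 421^2`; census image `Ns` (split Cartan normaliser `3Ns`); `#Ẽ(𝔽₃) = 2`, `a₃ = 2` (good
ORDINARY, NON-ANOMALOUS); Frobenius witness `ℓ = 13`: `#Ẽ(𝔽_{13}) = 17`, `a_{13} = -3`, `X² − a_{13}X + 13`
root-free mod `3` (`E[3]` irreducible). Cremona `allbsd`: analytic rank `0`, `#E(ℚ)_tors = 1`,
`∏ c_ℓ = 2`, `#Ш_an = 1` (so `L(E,1)/Ω_E = 2`, a `3`-adic unit). Displayed binders: PUBLISHED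
`hkato`, `hGr`, `h5`, `h3`; census `htam`, `hL`, `hSel`. Per pair; the class-level statement stays OPEN;
nothing booked. [cite: Kato2004Asterisque, Thm. 17.4 (1) (p. 273)] [cite: GreenbergLNM1716, Thm. 4.1 (p. 102) and Prop. 3.8 (p. 95)]
[cite: Mazur1978, §6 Prop. 6.3 (1) (p. 153)] [cite: Cremona2006, Table 1 (Cremona label 354482b1)] -/
theorem mazurMainConjecture_unit_u354482b1
    (hkato : ∀ (W : WeierstrassCurve ℚ) [W.IsElliptic] [W.IsGloballyMinimal] (p : ℕ) [Fact p.Prime]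
      (κ : ZpExtension ℚ p) (γ : Field.absoluteGaloisGroup ℚ) (N : ℕ) [NeZero N]
      (f : CuspForm (Gamma0 N) 2), kato_divisibility W p (κ := κ) (γ := γ) (f := f))
    (hGr : greenberg_charValue_rankZero) (h5 : realPeriodRat_eq_unit_mul_plusPeriod)
    (h3 : realPeriodRat_eq_unit_mul_plusPeriod_three)
    (W : WeierstrassCurve ℚ) [W.IsElliptic] [W.IsGloballyMinimal] [Fact (Nat.Prime 3)]
    (hI : integralModelInt W = ⟨1, 1, 0, (-7060), (-218544)⟩)
    (htam : ¬ 3 ∣ W.tamagawaProduct)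
    (hL : ∃ q : ℚ, q ≠ 0 ∧ W.entireLFunction 1 / (W.realPeriodRat : ℂ) = (q : ℂ) ∧ padicValRat 3 q = 0)
    (hSel : Nat.card (W.selmerGroupPInfty 3) = 1) :
    MazurMainConjecture W 3 :=
  haveI : Fact (Nat.Prime 13) := ⟨by norm_num⟩
  mazurMainConjecture_three_of_ainvs_of_trivialArithmetic hkato hGr h5 h3 1 1 0 (-7060) (-218544) hI
    13 17 2 (by decide +kernel) card_u354482b1_3 (by decide) (by decide) (by decide) (by decide +kernel)
    card_u354482b1_13 (by decide +kernel) htam hL hSel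

/-! ### `370999a1` (3Ns, N = 370999) -/

/-- `#Ẽ(𝔽_{3}) = 2` (`a₃ = 2`: good ORDINARY and NON-ANOMALOUS at `3`) for Cremona's model `370999a1` (kernel count). [folklore] -/
theorem card_u370999a1_3 :
    Nat.card (((⟨0, (-1), 1, (-79187523), (-271211849891)⟩ : WeierstrassCurve ℤ).map (Int.castRingHom (ZMod 3))).toAffine.Point) = 2 := by
  rw [@WeierstrassCurve.natCard_point_eq_one_add_card (ZMod 3) (@ZMod.instField 3 ⟨by norm_num⟩) _ _ _
    (by decide +kernel), @card_sol_eq_sum_euler (ZMod 3) (@ZMod.instField 3 ⟨by norm_num⟩) _ _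
    (by rw [ZMod.ringChar_zmod_n]; decide), ZMod.card]
  decide +kernel

/-- `#Ẽ(𝔽_{13}) = 17` (`a_{13} = -3`; `X² − a_{13}X + 13` root-free mod `3`) for Cremona's model `370999a1` (kernel count). [folklore] -/
theorem card_u370999a1_13 :
    Nat.card (((⟨0, (-1), 1, (-79187523), (-271211849891)⟩ : WeierstrassCurve ℤ).map (Int.castRingHom (ZMod 13))).toAffine.Point) = 17 := by
  rw [@WeierstrassCurve.natCard_point_eq_one_add_card (ZMod 13) (@ZMod.instField 13 ⟨by norm_num⟩) _ _ _
    (by decide +kernel), @card_sol_eq_sum_euler (ZMod 13) (@ZMod.instField 13 ⟨by norm_num⟩) _ _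
    (by rw [ZMod.ringChar_zmod_n]; decide), ZMod.card]
  decide +kernel

/-- **X_A3 AT THE PAIR `(370999a1, 3)` by the UNIT ROAD: `MazurMainConjecture W 3`.** Cremona model
`[0, -1, 1, -79187523, -271211849891]`, `N = 370999 = 37^2 · 271`; census image `Ns` (split Cartan normaliser `3Ns`); `#Ẽ(𝔽₃) = 2`, `a₃ = 2` (good
ORDINARY, NON-ANOMALOUS); Frobenius witness `ℓ = 13`: `#Ẽ(𝔽_{13}) = 17`, `a_{13} = -3`, `X² − a_{13}X + 13`
root-free mod `3` (`E[3]` irreducible). Cremona `allbsd`: analytic rank `0`, `#E(ℚ)_tors = 1`,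
`∏ c_ℓ = 2`, `#Ш_an = 16` (so `L(E,1)/Ω_E = 32`, a `3`-adic unit). Displayed binders: PUBLISHED
`hkato`, `hGr`, `h5`, `h3`; census `htam`, `hL`, `hSel`. Per pair; the class-level statement stays OPEN;
nothing booked. [cite: Kato2004Asterisque, Thm. 17.4 (1) (p. 273)] [cite: GreenbergLNM1716, Thm. 4.1 (p. 102) and Prop. 3.8 (p. 95)]
[cite: Mazur1978, §6 Prop. 6.3 (1) (p. 153)] [cite: Cremona2006, Table 1 (Cremona label 370999a1)] -/
theorem mazurMainConjecture_unit_u370999a1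
    (hkato : ∀ (W : WeierstrassCurve ℚ) [W.IsElliptic] [W.IsGloballyMinimal] (p : ℕ) [Fact p.Prime]
      (κ : ZpExtension ℚ p) (γ : Field.absoluteGaloisGroup ℚ) (N : ℕ) [NeZero N]
      (f : CuspForm (Gamma0 N) 2), kato_divisibility W p (κ := κ) (γ := γ) (f := f))
    (hGr : greenberg_charValue_rankZero) (h5 : realPeriodRat_eq_unit_mul_plusPeriod)
    (h3 : realPeriodRat_eq_unit_mul_plusPeriod_three)
    (W : WeierstrassCurve ℚ) [W.IsElliptic] [W.IsGloballyMinimal] [Fact (Nat.Prime 3)]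
    (hI : integralModelInt W = ⟨0, (-1), 1, (-79187523), (-271211849891)⟩)
    (htam : ¬ 3 ∣ W.tamagawaProduct)
    (hL : ∃ q : ℚ, q ≠ 0 ∧ W.entireLFunction 1 / (W.realPeriodRat : ℂ) = (q : ℂ) ∧ padicValRat 3 q = 0)
    (hSel : Nat.card (W.selmerGroupPInfty 3) = 1) :
    MazurMainConjecture W 3 :=
  haveI : Fact (Nat.Prime 13) := ⟨by norm_num⟩
  mazurMainConjecture_three_of_ainvs_of_trivialArithmetic hkato hGr h5 h3 0 (-1) 1 (-79187523) (-271211849891) hI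
    13 17 2 (by decide +kernel) card_u370999a1_3 (by decide) (by decide) (by decide) (by decide +kernel)
    card_u370999a1_13 (by decide +kernel) htam hL hSel

/-! ### `370999b1` (3Ns, N = 370999) -/

/-- `#Ẽ(𝔽_{3}) = 2` (`a₃ = 2`: good ORDINARY and NON-ANOMALOUS at `3`) for Cremona's model `370999b1` (kernel count). [folklore] -/
theorem card_u370999b1_3 :
    Nat.card (((⟨0, (-1), 1, (-57843), (-5335550)⟩ : WeierstrassCurve ℤ).map (Int.castRingHom (ZMod 3))).toAffine.Point) = 2 := by
  rw [@WeierstrassCurve.natCard_point_eq_one_add_card (ZMod 3) (@ZMod.instField 3 ⟨by norm_num⟩) _ _ _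
    (by decide +kernel), @card_sol_eq_sum_euler (ZMod 3) (@ZMod.instField 3 ⟨by norm_num⟩) _ _
    (by rw [ZMod.ringChar_zmod_n]; decide), ZMod.card]
  decide +kernel

/-- `#Ẽ(𝔽_{13}) = 11` (`a_{13} = 3`; `X² − a_{13}X + 13` root-free mod `3`) for Cremona's model `370999b1` (kernel count). [folklore] -/
theorem card_u370999b1_13 :
    Nat.card (((⟨0, (-1), 1, (-57843), (-5335550)⟩ : WeierstrassCurve ℤ).map (Int.castRingHom (ZMod 13))).toAffine.Point) = 11 := by
  rw [@WeierstrassCurve.natCard_point_eq_one_add_card (ZMod 13) (@ZMod.instField 13 ⟨by norm_num⟩) _ _ _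
    (by decide +kernel), @card_sol_eq_sum_euler (ZMod 13) (@ZMod.instField 13 ⟨by norm_num⟩) _ _
    (by rw [ZMod.ringChar_zmod_n]; decide), ZMod.card]
  decide +kernel

/-- **X_A3 AT THE PAIR `(370999b1, 3)` by the UNIT ROAD: `MazurMainConjecture W 3`.** Cremona model
`[0, -1, 1, -57843, -5335550]`, `N = 370999 = 37^2 · 271`; census image `Ns` (split Cartan normaliser `3Ns`); `#Ẽ(𝔽₃) = 2`, `a₃ = 2` (good
ORDINARY, NON-ANOMALOUS); Frobenius witness `ℓ = 13`: `#Ẽ(𝔽_{13}) = 11`, `a_{13} = 3`, `X² − a_{13}X + 13`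
root-free mod `3` (`E[3]` irreducible). Cremona `allbsd`: analytic rank `0`, `#E(ℚ)_tors = 1`,
`∏ c_ℓ = 2`, `#Ш_an = 4` (so `L(E,1)/Ω_E = 8`, a `3`-adic unit). Displayed binders: PUBLISHED
`hkato`, `hGr`, `h5`, `h3`; census `htam`, `hL`, `hSel`. Per pair; the class-level statement stays OPEN;
nothing booked. [cite: Kato2004Asterisque, Thm. 17.4 (1) (p. 273)] [cite: GreenbergLNM1716, Thm. 4.1 (p. 102) and Prop. 3.8 (p. 95)]
[cite: Mazur1978, §6 Prop. 6.3 (1) (p. 153)] [cite: Cremona2006, Table 1 (Cremona label 370999b1)] -/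
theorem mazurMainConjecture_unit_u370999b1
    (hkato : ∀ (W : WeierstrassCurve ℚ) [W.IsElliptic] [W.IsGloballyMinimal] (p : ℕ) [Fact p.Prime]
      (κ : ZpExtension ℚ p) (γ : Field.absoluteGaloisGroup ℚ) (N : ℕ) [NeZero N]
      (f : CuspForm (Gamma0 N) 2), kato_divisibility W p (κ := κ) (γ := γ) (f := f))
    (hGr : greenberg_charValue_rankZero) (h5 : realPeriodRat_eq_unit_mul_plusPeriod)
    (h3 : realPeriodRat_eq_unit_mul_plusPeriod_three)
    (W : WeierstrassCurve ℚ) [W.IsElliptic] [W.IsGloballyMinimal] [Fact (Nat.Prime 3)]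
    (hI : integralModelInt W = ⟨0, (-1), 1, (-57843), (-5335550)⟩)
    (htam : ¬ 3 ∣ W.tamagawaProduct)
    (hL : ∃ q : ℚ, q ≠ 0 ∧ W.entireLFunction 1 / (W.realPeriodRat : ℂ) = (q : ℂ) ∧ padicValRat 3 q = 0)
    (hSel : Nat.card (W.selmerGroupPInfty 3) = 1) :
    MazurMainConjecture W 3 :=
  haveI : Fact (Nat.Prime 13) := ⟨by norm_num⟩
  mazurMainConjecture_three_of_ainvs_of_trivialArithmetic hkato hGr h5 h3 0 (-1) 1 (-57843) (-5335550) hI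
    13 11 2 (by decide +kernel) card_u370999b1_3 (by decide) (by decide) (by decide) (by decide +kernel)
    card_u370999b1_13 (by decide +kernel) htam hL hSel

/-! ### `372416df1` (3Ns, N = 372416) -/

/-- `#Ẽ(𝔽_{3}) = 2` (`a₃ = 2`: good ORDINARY and NON-ANOMALOUS at `3`) for Cremona's model `372416df1` (kernel count). [folklore] -/
theorem card_u372416df1_3 :
    Nat.card (((⟨0, (-1), 0, (-33089), 590657⟩ : WeierstrassCurve ℤ).map (Int.castRingHom (ZMod 3))).toAffine.Point) = 2 := by
  rw [@WeierstrassCurve.natCard_point_eq_one_add_card (ZMod 3) (@ZMod.instField 3 ⟨by norm_num⟩) _ _ _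
    (by decide +kernel), @card_sol_eq_sum_euler (ZMod 3) (@ZMod.instField 3 ⟨by norm_num⟩) _ _
    (by rw [ZMod.ringChar_zmod_n]; decide), ZMod.card]
  decide +kernel

/-- `#Ẽ(𝔽_{7}) = 11` (`a_{7} = -3`; `X² − a_{7}X + 7` root-free mod `3`) for Cremona's model `372416df1` (kernel count). [folklore] -/
theorem card_u372416df1_7 :
    Nat.card (((⟨0, (-1), 0, (-33089), 590657⟩ : WeierstrassCurve ℤ).map (Int.castRingHom (ZMod 7))).toAffine.Point) = 11 := by
  rw [@WeierstrassCurve.natCard_point_eq_one_add_card (ZMod 7) (@ZMod.instField 7 ⟨by norm_num⟩) _ _ _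
    (by decide +kernel), @card_sol_eq_sum_euler (ZMod 7) (@ZMod.instField 7 ⟨by norm_num⟩) _ _
    (by rw [ZMod.ringChar_zmod_n]; decide), ZMod.card]
  decide +kernel

/-- **X_A3 AT THE PAIR `(372416df1, 3)` by the UNIT ROAD: `MazurMainConjecture W 3`.** Cremona model
`[0, -1, 0, -33089, 590657]`, `N = 372416 = 2^6 · 11 · 23^2`; census image `Ns` (split Cartan normaliser `3Ns`); `#Ẽ(𝔽₃) = 2`, `a₃ = 2` (good
ORDINARY, NON-ANOMALOUS); Frobenius witness `ℓ = 7`: `#Ẽ(𝔽_{7}) = 11`, `a_{7} = -3`, `X² − a_{7}X + 7`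
root-free mod `3` (`E[3]` irreducible). Cremona `allbsd`: analytic rank `0`, `#E(ℚ)_tors = 1`,
`∏ c_ℓ = 4`, `#Ш_an = 4` (so `L(E,1)/Ω_E = 16`, a `3`-adic unit). Displayed binders: PUBLISHED
`hkato`, `hGr`, `h5`, `h3`; census `htam`, `hL`, `hSel`. Per pair; the class-level statement stays OPEN;
nothing booked. [cite: Kato2004Asterisque, Thm. 17.4 (1) (p. 273)] [cite: GreenbergLNM1716, Thm. 4.1 (p. 102) and Prop. 3.8 (p. 95)]
[cite: Mazur1978, §6 Prop. 6.3 (1) (p. 153)] [cite: Cremona2006, Table 1 (Cremona label 372416df1)] -/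
theorem mazurMainConjecture_unit_u372416df1
    (hkato : ∀ (W : WeierstrassCurve ℚ) [W.IsElliptic] [W.IsGloballyMinimal] (p : ℕ) [Fact p.Prime]
      (κ : ZpExtension ℚ p) (γ : Field.absoluteGaloisGroup ℚ) (N : ℕ) [NeZero N]
      (f : CuspForm (Gamma0 N) 2), kato_divisibility W p (κ := κ) (γ := γ) (f := f))
    (hGr : greenberg_charValue_rankZero) (h5 : realPeriodRat_eq_unit_mul_plusPeriod)
    (h3 : realPeriodRat_eq_unit_mul_plusPeriod_three)
    (W : WeierstrassCurve ℚ) [W.IsElliptic] [W.IsGloballyMinimal] [Fact (Nat.Prime 3)]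
    (hI : integralModelInt W = ⟨0, (-1), 0, (-33089), 590657⟩)
    (htam : ¬ 3 ∣ W.tamagawaProduct)
    (hL : ∃ q : ℚ, q ≠ 0 ∧ W.entireLFunction 1 / (W.realPeriodRat : ℂ) = (q : ℂ) ∧ padicValRat 3 q = 0)
    (hSel : Nat.card (W.selmerGroupPInfty 3) = 1) :
    MazurMainConjecture W 3 :=
  haveI : Fact (Nat.Prime 7) := ⟨by norm_num⟩
  mazurMainConjecture_three_of_ainvs_of_trivialArithmetic hkato hGr h5 h3 0 (-1) 0 (-33089) 590657 hI
    7 11 2 (by decide +kernel) card_u372416df1_3 (by decide) (by decide) (by decide) (by decide +kernel)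
    card_u372416df1_7 (by decide +kernel) htam hL hSel

/-! ### `406783b1` (3Ns, N = 406783) -/

/-- `#Ẽ(𝔽_{3}) = 2` (`a₃ = 2`: good ORDINARY and NON-ANOMALOUS at `3`) for Cremona's model `406783b1` (kernel count). [folklore] -/
theorem card_u406783b1_3 :
    Nat.card (((⟨0, (-1), 1, 62981, (-585072187)⟩ : WeierstrassCurve ℤ).map (Int.castRingHom (ZMod 3))).toAffine.Point) = 2 := by
  rw [@WeierstrassCurve.natCard_point_eq_one_add_card (ZMod 3) (@ZMod.instField 3 ⟨by norm_num⟩) _ _ _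
    (by decide +kernel), @card_sol_eq_sum_euler (ZMod 3) (@ZMod.instField 3 ⟨by norm_num⟩) _ _
    (by rw [ZMod.ringChar_zmod_n]; decide), ZMod.card]
  decide +kernel

/-- `#Ẽ(𝔽_{7}) = 8` (`a_{7} = 0`; `X² − a_{7}X + 7` root-free mod `3`) for Cremona's model `406783b1` (kernel count). [folklore] -/
theorem card_u406783b1_7 :
    Nat.card (((⟨0, (-1), 1, 62981, (-585072187)⟩ : WeierstrassCurve ℤ).map (Int.castRingHom (ZMod 7))).toAffine.Point) = 8 := by
  rw [@WeierstrassCurve.natCard_point_eq_one_add_card (ZMod 7) (@ZMod.instField 7 ⟨by norm_num⟩) _ _ _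
    (by decide +kernel), @card_sol_eq_sum_euler (ZMod 7) (@ZMod.instField 7 ⟨by norm_num⟩) _ _
    (by rw [ZMod.ringChar_zmod_n]; decide), ZMod.card]
  decide +kernel

/-- **X_A3 AT THE PAIR `(406783b1, 3)` by the UNIT ROAD: `MazurMainConjecture W 3`.** Cremona model
`[0, -1, 1, 62981, -585072187]`, `N = 406783 = 13^2 · 29 · 83`; census image `Ns` (split Cartan normaliser `3Ns`); `#Ẽ(𝔽₃) = 2`, `a₃ = 2` (good
ORDINARY, NON-ANOMALOUS); Frobenius witness `ℓ = 7`: `#Ẽ(𝔽_{7}) = 8`, `a_{7} = 0`, `X² − a_{7}X + 7`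
root-free mod `3` (`E[3]` irreducible). Cremona `allbsd`: analytic rank `0`, `#E(ℚ)_tors = 1`,
`∏ c_ℓ = 2`, `#Ш_an = 16` (so `L(E,1)/Ω_E = 32`, a `3`-adic unit). Displayed binders: PUBLISHED
`hkato`, `hGr`, `h5`, `h3`; census `htam`, `hL`, `hSel`. Per pair; the class-level statement stays OPEN;
nothing booked. [cite: Kato2004Asterisque, Thm. 17.4 (1) (p. 273)] [cite: GreenbergLNM1716, Thm. 4.1 (p. 102) and Prop. 3.8 (p. 95)]
[cite: Mazur1978, §6 Prop. 6.3 (1) (p. 153)] [cite: Cremona2006, Table 1 (Cremona label 406783b1)] -/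
theorem mazurMainConjecture_unit_u406783b1
    (hkato : ∀ (W : WeierstrassCurve ℚ) [W.IsElliptic] [W.IsGloballyMinimal] (p : ℕ) [Fact p.Prime]
      (κ : ZpExtension ℚ p) (γ : Field.absoluteGaloisGroup ℚ) (N : ℕ) [NeZero N]
      (f : CuspForm (Gamma0 N) 2), kato_divisibility W p (κ := κ) (γ := γ) (f := f))
    (hGr : greenberg_charValue_rankZero) (h5 : realPeriodRat_eq_unit_mul_plusPeriod)
    (h3 : realPeriodRat_eq_unit_mul_plusPeriod_three)
    (W : WeierstrassCurve ℚ) [W.IsElliptic] [W.IsGloballyMinimal] [Fact (Nat.Prime 3)]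
    (hI : integralModelInt W = ⟨0, (-1), 1, 62981, (-585072187)⟩)
    (htam : ¬ 3 ∣ W.tamagawaProduct)
    (hL : ∃ q : ℚ, q ≠ 0 ∧ W.entireLFunction 1 / (W.realPeriodRat : ℂ) = (q : ℂ) ∧ padicValRat 3 q = 0)
    (hSel : Nat.card (W.selmerGroupPInfty 3) = 1) :
    MazurMainConjecture W 3 :=
  haveI : Fact (Nat.Prime 7) := ⟨by norm_num⟩
  mazurMainConjecture_three_of_ainvs_of_trivialArithmetic hkato hGr h5 h3 0 (-1) 1 62981 (-585072187) hI
    7 8 2 (by decide +kernel) card_u406783b1_3 (by decide) (by decide) (by decide) (by decide +kernel)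
    card_u406783b1_7 (by decide +kernel) htam hL hSel

/-! ### `440896k1` (3Ns, N = 440896) -/

/-- `#Ẽ(𝔽_{3}) = 5` (`a₃ = -1`: good ORDINARY and NON-ANOMALOUS at `3`) for Cremona's model `440896k1` (kernel count). [folklore] -/
theorem card_u440896k1_3 :
    Nat.card (((⟨0, (-1), 0, (-26683393), (-100363696735)⟩ : WeierstrassCurve ℤ).map (Int.castRingHom (ZMod 3))).toAffine.Point) = 5 := by
  rw [@WeierstrassCurve.natCard_point_eq_one_add_card (ZMod 3) (@ZMod.instField 3 ⟨by norm_num⟩) _ _ _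
    (by decide +kernel), @card_sol_eq_sum_euler (ZMod 3) (@ZMod.instField 3 ⟨by norm_num⟩) _ _
    (by rw [ZMod.ringChar_zmod_n]; decide), ZMod.card]
  decide +kernel

/-- `#Ẽ(𝔽_{13}) = 20` (`a_{13} = -6`; `X² − a_{13}X + 13` root-free mod `3`) for Cremona's model `440896k1` (kernel count). [folklore] -/
theorem card_u440896k1_13 :
    Nat.card (((⟨0, (-1), 0, (-26683393), (-100363696735)⟩ : WeierstrassCurve ℤ).map (Int.castRingHom (ZMod 13))).toAffine.Point) = 20 := by
  rw [@WeierstrassCurve.natCard_point_eq_one_add_card (ZMod 13) (@ZMod.instField 13 ⟨by norm_num⟩) _ _ _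
    (by decide +kernel), @card_sol_eq_sum_euler (ZMod 13) (@ZMod.instField 13 ⟨by norm_num⟩) _ _
    (by rw [ZMod.ringChar_zmod_n]; decide), ZMod.card]
  decide +kernel

/-- **X_A3 AT THE PAIR `(440896k1, 3)` by the UNIT ROAD: `MazurMainConjecture W 3`.** Cremona model
`[0, -1, 0, -26683393, -100363696735]`, `N = 440896 = 2^6 · 83^2`; census image `Ns` (split Cartan normaliser `3Ns`); `#Ẽ(𝔽₃) = 5`, `a₃ = -1` (good
ORDINARY, NON-ANOMALOUS); Frobenius witness `ℓ = 13`: `#Ẽ(𝔽_{13}) = 20`, `a_{13} = -6`, `X² − a_{13}X + 13`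
root-free mod `3` (`E[3]` irreducible). Cremona `allbsd`: analytic rank `0`, `#E(ℚ)_tors = 1`,
`∏ c_ℓ = 4`, `#Ш_an = 1` (so `L(E,1)/Ω_E = 4`, a `3`-adic unit). Displayed binders: PUBLISHED
`hkato`, `hGr`, `h5`, `h3`; census `htam`, `hL`, `hSel`. Per pair; the class-level statement stays OPEN;
nothing booked. [cite: Kato2004Asterisque, Thm. 17.4 (1) (p. 273)] [cite: GreenbergLNM1716, Thm. 4.1 (p. 102) and Prop. 3.8 (p. 95)]
[cite: Mazur1978, §6 Prop. 6.3 (1) (p. 153)] [cite: Cremona2006, Table 1 (Cremona label 440896k1)] -/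
theorem mazurMainConjecture_unit_u440896k1
    (hkato : ∀ (W : WeierstrassCurve ℚ) [W.IsElliptic] [W.IsGloballyMinimal] (p : ℕ) [Fact p.Prime]
      (κ : ZpExtension ℚ p) (γ : Field.absoluteGaloisGroup ℚ) (N : ℕ) [NeZero N]
      (f : CuspForm (Gamma0 N) 2), kato_divisibility W p (κ := κ) (γ := γ) (f := f))
    (hGr : greenberg_charValue_rankZero) (h5 : realPeriodRat_eq_unit_mul_plusPeriod)
    (h3 : realPeriodRat_eq_unit_mul_plusPeriod_three)
    (W : WeierstrassCurve ℚ) [W.IsElliptic] [W.IsGloballyMinimal] [Fact (Nat.Prime 3)]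
    (hI : integralModelInt W = ⟨0, (-1), 0, (-26683393), (-100363696735)⟩)
    (htam : ¬ 3 ∣ W.tamagawaProduct)
    (hL : ∃ q : ℚ, q ≠ 0 ∧ W.entireLFunction 1 / (W.realPeriodRat : ℂ) = (q : ℂ) ∧ padicValRat 3 q = 0)
    (hSel : Nat.card (W.selmerGroupPInfty 3) = 1) :
    MazurMainConjecture W 3 :=
  haveI : Fact (Nat.Prime 13) := ⟨by norm_num⟩
  mazurMainConjecture_three_of_ainvs_of_trivialArithmetic hkato hGr h5 h3 0 (-1) 0 (-26683393) (-100363696735) hI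
    13 20 5 (by decide +kernel) card_u440896k1_3 (by decide) (by decide) (by decide) (by decide +kernel)
    card_u440896k1_13 (by decide +kernel) htam hL hSel

/-! ### `440896l1` (3Ns, N = 440896) -/

/-- `#Ẽ(𝔽_{3}) = 5` (`a₃ = -1`: good ORDINARY and NON-ANOMALOUS at `3`) for Cremona's model `440896l1` (kernel count). [folklore] -/
theorem card_u440896l1_3 :
    Nat.card (((⟨0, (-1), 0, (-3873), 176833⟩ : WeierstrassCurve ℤ).map (Int.castRingHom (ZMod 3))).toAffine.Point) = 5 := by
  rw [@WeierstrassCurve.natCard_point_eq_one_add_card (ZMod 3) (@ZMod.instField 3 ⟨by norm_num⟩) _ _ _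
    (by decide +kernel), @card_sol_eq_sum_euler (ZMod 3) (@ZMod.instField 3 ⟨by norm_num⟩) _ _
    (by rw [ZMod.ringChar_zmod_n]; decide), ZMod.card]
  decide +kernel

/-- `#Ẽ(𝔽_{13}) = 8` (`a_{13} = 6`; `X² − a_{13}X + 13` root-free mod `3`) for Cremona's model `440896l1` (kernel count). [folklore] -/
theorem card_u440896l1_13 :
    Nat.card (((⟨0, (-1), 0, (-3873), 176833⟩ : WeierstrassCurve ℤ).map (Int.castRingHom (ZMod 13))).toAffine.Point) = 8 := by
  rw [@WeierstrassCurve.natCard_point_eq_one_add_card (ZMod 13) (@ZMod.instField 13 ⟨by norm_num⟩) _ _ _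
    (by decide +kernel), @card_sol_eq_sum_euler (ZMod 13) (@ZMod.instField 13 ⟨by norm_num⟩) _ _
    (by rw [ZMod.ringChar_zmod_n]; decide), ZMod.card]
  decide +kernel

/-- **X_A3 AT THE PAIR `(440896l1, 3)` by the UNIT ROAD: `MazurMainConjecture W 3`.** Cremona model
`[0, -1, 0, -3873, 176833]`, `N = 440896 = 2^6 · 83^2`; census image `Ns` (split Cartan normaliser `3Ns`); `#Ẽ(𝔽₃) = 5`, `a₃ = -1` (good
ORDINARY, NON-ANOMALOUS); Frobenius witness `ℓ = 13`: `#Ẽ(𝔽_{13}) = 8`, `a_{13} = 6`, `X² − a_{13}X + 13`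
root-free mod `3` (`E[3]` irreducible). Cremona `allbsd`: analytic rank `0`, `#E(ℚ)_tors = 1`,
`∏ c_ℓ = 4`, `#Ш_an = 1` (so `L(E,1)/Ω_E = 4`, a `3`-adic unit). Displayed binders: PUBLISHED
`hkato`, `hGr`, `h5`, `h3`; census `htam`, `hL`, `hSel`. Per pair; the class-level statement stays OPEN;
nothing booked. [cite: Kato2004Asterisque, Thm. 17.4 (1) (p. 273)] [cite: GreenbergLNM1716, Thm. 4.1 (p. 102) and Prop. 3.8 (p. 95)]
[cite: Mazur1978, §6 Prop. 6.3 (1) (p. 153)] [cite: Cremona2006, Table 1 (Cremona label 440896l1)] -/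
theorem mazurMainConjecture_unit_u440896l1
    (hkato : ∀ (W : WeierstrassCurve ℚ) [W.IsElliptic] [W.IsGloballyMinimal] (p : ℕ) [Fact p.Prime]
      (κ : ZpExtension ℚ p) (γ : Field.absoluteGaloisGroup ℚ) (N : ℕ) [NeZero N]
      (f : CuspForm (Gamma0 N) 2), kato_divisibility W p (κ := κ) (γ := γ) (f := f))
    (hGr : greenberg_charValue_rankZero) (h5 : realPeriodRat_eq_unit_mul_plusPeriod)
    (h3 : realPeriodRat_eq_unit_mul_plusPeriod_three)
    (W : WeierstrassCurve ℚ) [W.IsElliptic] [W.IsGloballyMinimal] [Fact (Nat.Prime 3)]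
    (hI : integralModelInt W = ⟨0, (-1), 0, (-3873), 176833⟩)
    (htam : ¬ 3 ∣ W.tamagawaProduct)
    (hL : ∃ q : ℚ, q ≠ 0 ∧ W.entireLFunction 1 / (W.realPeriodRat : ℂ) = (q : ℂ) ∧ padicValRat 3 q = 0)
    (hSel : Nat.card (W.selmerGroupPInfty 3) = 1) :
    MazurMainConjecture W 3 :=
  haveI : Fact (Nat.Prime 13) := ⟨by norm_num⟩
  mazurMainConjecture_three_of_ainvs_of_trivialArithmetic hkato hGr h5 h3 0 (-1) 0 (-3873) 176833 hI
    13 8 5 (by decide +kernel) card_u440896l1_3 (by decide) (by decide) (by decide) (by decide +kernel)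
    card_u440896l1_13 (by decide +kernel) htam hL hSel

end Summit.BirchSwinnertonDyer.Rank1Residual.X10.UnitRoad
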